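import Mathlib
import HarnessLib

/-!
# Minimal primes under localisation: an injection along isomorphic localisations

Topic: `Literature/RingTheory/Localization`. For a multiplicative subset `S ⊆ R`, the prime ideals
of `S⁻¹R` are in order-preserving bijection with the primes of `R` not meeting `S`
(Atiyah–Macdonald, *Introduction to Commutative Algebra*, Prop. 3.11 (iv)); in particular the
minimal primes of `S⁻¹R` are the extensions of the minimal primes of `R` not meeting `S`, and the
contraction of a minimal prime of `S⁻¹R` is a minimal prime of `R` (Mathlib:
`IsLocalization.minimalPrimes_map` / `IsLocalization.minimalPrimes_comap`). We record the
consequence used to compare numbers of irreducible components along a birational isomorphism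
given on basic open sets:

* `under_mem_minimalPrimes_of_isLocalization` — the contraction of a minimal prime of a
  localisation is a minimal prime;
* `map_mem_minimalPrimes_of_isLocalization` — the extension of a minimal prime not meeting `S` is
  a minimal prime of the localisation;
* `ncard_minimalPrimes_le_of_ringEquiv_localization` — **if `S⁻¹R ≅ S'⁻¹R'` as rings and no
  minimal prime of `R` meets `S`, then `R` has at most as many minimal primes as `R'`** (when
  `R'` has finitely many);
* `ncard_minimalPrimes_le_of_ringEquiv_away` — the case of basic open sets `R[1/f] ≅ R'[1/f']`
  with `f` outside every minimal prime of `R`;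
* `ncard_minimalPrimes_quotient` — `#(I.minimalPrimes) = #(minimal primes of R ⧸ I)`.
* `existsUnique_minimalPrimes_le_iff_isPrime_radical_map` — at a prime `q ⊇ I`: **exactly one
  minimal prime over `I` lies inside `q` iff the radical of `I R_q` is prime** (Atiyah–Macdonald
  Cor. 3.13: primes of `R_q` ↔ primes of `R` inside `q`); geometrically, a point of `V(I)` lies on
  exactly one irreducible component iff `V(I)` is irreducible in the local ring at the point; with
  the sufficient conditions `…_of_isPrime_radical` (globally irreducible `V(I)`) and
  `…_of_isDomain_quotient_map` (`R_q ⧸ I R_q` a domain, e.g. a regular local ring).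

## References

* M. F. Atiyah, I. G. Macdonald, *Introduction to Commutative Algebra* (1969), Prop. 3.11 (iv),
  and Ch. 4 (minimal primes). [AtiyahMacdonald1969]
-/

namespace Literature.RingTheory.Localization

open Ideal

section General

variable {R A : Type*} [CommRing R] [CommRing A] [Algebra R A]

/-- The contraction to `R` of a minimal prime of the localisation `S⁻¹R` is a minimal prime of `R`.
[cite: AtiyahMacdonald1969, Prop. 3.11 (iv)] -/
theorem under_mem_minimalPrimes_of_isLocalization (S : Submonoid R) [IsLocalization S A]
    {P : Ideal A} (hP : P ∈ minimalPrimes A) : P.under R ∈ minimalPrimes R := by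
  have h := IsLocalization.minimalPrimes_map S A (⊥ : Ideal R)
  rw [Ideal.map_bot] at h
  have hP' : P ∈ (⊥ : Ideal A).minimalPrimes := hP
  rw [h] at hP'
  exact hP'

/-- The extension to `S⁻¹R` of a minimal prime of `R` not meeting `S` is a minimal prime of
`S⁻¹R`, contracting back to the given prime. [cite: AtiyahMacdonald1969, Prop. 3.11 (iv)] -/
theorem map_mem_minimalPrimes_of_isLocalization (S : Submonoid R) [IsLocalization S A]
    {p : Ideal R} (hp : p ∈ minimalPrimes R) (hS : Disjoint (S : Set R) p) :
    p.map (algebraMap R A) ∈ minimalPrimes A ∧ (p.map (algebraMap R A)).under R = p := by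
  haveI : p.IsPrime := hp.1.1
  have hunder : (p.map (algebraMap R A)).under R = p :=
    IsLocalization.under_map_of_isPrime_disjoint S A inferInstance hS
  refine ⟨?_, hunder⟩
  have h := IsLocalization.minimalPrimes_map S A (⊥ : Ideal R)
  rw [Ideal.map_bot] at h
  show p.map (algebraMap R A) ∈ (⊥ : Ideal A).minimalPrimes
  rw [h, Set.mem_preimage, hunder]
  exact hp

end General

section Compare

variable {R A R' A' : Type*} [CommRing R] [CommRing A] [Algebra R A] [CommRing R'] [CommRing A']
  [Algebra R' A']

/-- A ring isomorphism carries minimal primes to minimal primes (through `comap` of its inverse).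
[folklore] -/
private theorem comap_symm_mem_minimalPrimes (e : A ≃+* A') {P : Ideal A} (hP : P ∈ minimalPrimes A) :
    P.comap (e.symm : A' →+* A) ∈ minimalPrimes A' := by
  have hsurj : Function.Surjective (e.symm : A' →+* A) := e.symm.surjective
  have h := Ideal.comap_minimalPrimes_eq_of_surjective hsurj (⊥ : Ideal A)
  have hker : (⊥ : Ideal A).comap (e.symm : A' →+* A) = ⊥ := by
    rw [← RingHom.ker_eq_comap_bot]
    exact RingHom.injective_iff_ker_eq_bot _ |>.1 e.symm.injective
  rw [hker] at h
  have : P.comap (e.symm : A' →+* A) ∈ Ideal.comap (e.symm : A' →+* A) '' (⊥ : Ideal A).minimalPrimes :=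
    ⟨P, hP, rfl⟩
  rw [← h] at this
  exact this

/-- **Comparison of the numbers of minimal primes along isomorphic localisations.** If
`S⁻¹R ≅ S'⁻¹R'` and no minimal prime of `R` meets `S`, then extension, transport and contraction
inject the minimal primes of `R` into those of `R'`; so when `R'` has finitely many minimal primes,
`R` has at most as many. [cite: AtiyahMacdonald1969, Prop. 3.11 (iv)] -/
theorem ncard_minimalPrimes_le_of_ringEquiv_localization (S : Submonoid R) [IsLocalization S A]
    (S' : Submonoid R') [IsLocalization S' A'] (e : A ≃+* A')
    (hS : ∀ p ∈ minimalPrimes R, Disjoint (S : Set R) p) (hfin : (minimalPrimes R').Finite) :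
    (minimalPrimes R).ncard ≤ (minimalPrimes R').ncard := by
  classical
  -- the map
  let ψ : Ideal R → Ideal R' := fun p =>
    ((p.map (algebraMap R A)).comap (e.symm : A' →+* A)).under R'
  have hmaps : Set.MapsTo ψ (minimalPrimes R) (minimalPrimes R') := by
    intro p hp
    obtain ⟨hPA, -⟩ := map_mem_minimalPrimes_of_isLocalization (A := A) S hp (hS p hp)
    exact under_mem_minimalPrimes_of_isLocalization (A := A') S' (comap_symm_mem_minimalPrimes e hPA)
  have hinj : Set.InjOn ψ (minimalPrimes R) := by
    intro p hp q hq hpq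
    obtain ⟨hPA, hpu⟩ := map_mem_minimalPrimes_of_isLocalization (A := A) S hp (hS p hp)
    obtain ⟨hQA, hqu⟩ := map_mem_minimalPrimes_of_isLocalization (A := A) S hq (hS q hq)
    -- primes of a localisation are determined by their contractions
    have key : ∀ P Q : Ideal A', P.IsPrime → Q.IsPrime → P.under R' = Q.under R' → P = Q := by
      intro P Q _ _ h
      rw [← IsLocalization.map_under S' A' P, ← IsLocalization.map_under S' A' Q]
      exact congrArg _ h
    haveI h1 : ((p.map (algebraMap R A)).comap (e.symm : A' →+* A)).IsPrime :=
      (comap_symm_mem_minimalPrimes e hPA).1.1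
    haveI h2 : ((q.map (algebraMap R A)).comap (e.symm : A' →+* A)).IsPrime :=
      (comap_symm_mem_minimalPrimes e hQA).1.1
    have h3 := key _ _ h1 h2 hpq
    have h4 : p.map (algebraMap R A) = q.map (algebraMap R A) := by
      have := congrArg (Ideal.comap (e : A →+* A')) h3
      rwa [Ideal.comap_comap, Ideal.comap_comap, show (↑e.symm : A' →+* A).comp (↑e : A →+* A') =
        RingHom.id A from by ext x; simp, Ideal.comap_id, Ideal.comap_id] at this
    rw [← hpu, ← hqu, h4]
  exact Set.ncard_le_ncard_of_injOn ψ hmaps hinj hfin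

/-- The case of basic open sets: if `R[1/f] ≅ R'[1/f']` and `f` lies in no minimal prime of `R`,
then `R` has at most as many minimal primes as `R'` (finitely many).
[cite: AtiyahMacdonald1969, Prop. 3.11 (iv)] -/
theorem ncard_minimalPrimes_le_of_ringEquiv_away (f : R) (f' : R')
    [IsLocalization.Away f A] [IsLocalization.Away f' A'] (e : A ≃+* A')
    (hf : ∀ p ∈ minimalPrimes R, f ∉ p) (hfin : (minimalPrimes R').Finite) :
    (minimalPrimes R).ncard ≤ (minimalPrimes R').ncard := by
  refine ncard_minimalPrimes_le_of_ringEquiv_localization (Submonoid.powers f) (Submonoid.powers f')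
    e (fun p hp => ?_) hfin
  haveI : p.IsPrime := hp.1.1
  rw [Set.disjoint_left]
  rintro x ⟨k, rfl⟩ hx
  exact hf p hp (Ideal.IsPrime.mem_of_pow_mem inferInstance k hx)

end Compare

section Quotient

variable {R : Type*} [CommRing R]

/-- `#(I.minimalPrimes) = #(minimal primes of R ⧸ I)`: the minimal primes over `I` are the
contractions of the minimal primes of the quotient, injectively (the correspondence of ideals of
`R ⧸ I` with ideals of `R` containing `I`). [cite: AtiyahMacdonald1969, Prop. 1.1] -/
theorem ncard_minimalPrimes_quotient (I : Ideal R) :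
    I.minimalPrimes.ncard = (minimalPrimes (R ⧸ I)).ncard := by
  rw [Ideal.minimalPrimes_eq_comap]
  exact Set.ncard_image_of_injective _ (Ideal.comap_injective_of_surjective _ Ideal.Quotient.mk_surjective)

end Quotient

section AtPrime

variable {R A : Type*} [CommRing R] [CommRing A] [Algebra R A]

/-- A prime of the localisation `R_q` contracts to a prime of `R` contained in `q`.
[cite: AtiyahMacdonald1969, Cor. 3.13] -/
theorem under_le_of_isPrime_of_isLocalization_atPrime (q : Ideal R) [q.IsPrime]
    [IsLocalization.AtPrime A q] (P : Ideal A) [P.IsPrime] : P.under R ≤ q :=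
  ((IsLocalization.AtPrime.orderIsoOfPrime A q) ⟨P, inferInstance⟩).2.2

/-- **One minimal prime below a prime, read in the local ring.** Let `q ⊇ I` be a prime of `R`
and `R_q` the localisation. Exactly one minimal prime over `I` is contained in `q` if and only
if the radical of the extended ideal `I R_q` is prime — i.e. iff `R_q ⧸ I R_q` has irreducible
spectrum. (The minimal primes over `I R_q` are the extensions of the minimal primes over `I`
inside `q`, Atiyah–Macdonald Cor. 3.13 / Prop. 3.11 (iv), Mathlib
`IsLocalization.minimalPrimes_map`; a radical ideal is prime iff it has exactly one minimal
prime.) Geometrically: a point `y` of an affine scheme `V(I)` lies on exactly one irreducible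
component iff `V(I)` is locally irreducible at `y`; in particular this holds when the local ring
of `V(I)` at `y` is a domain (e.g. regular, i.e. `y` a smooth point).
[cite: AtiyahMacdonald1969, Cor. 3.13] -/
theorem existsUnique_minimalPrimes_le_iff_isPrime_radical_map (q : Ideal R) [q.IsPrime]
    [IsLocalization.AtPrime A q] (I : Ideal R) :
    (∃! p, p ∈ I.minimalPrimes ∧ p ≤ q) ↔ (I.map (algebraMap R A)).radical.IsPrime := by
  have hmin := IsLocalization.minimalPrimes_map q.primeCompl A I
  -- a minimal prime over `I` inside `q` extends to a minimal prime over `I R_q` contracting back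
  have hext : ∀ p ∈ I.minimalPrimes, p ≤ q →
      (p.map (algebraMap R A)).IsPrime ∧ (p.map (algebraMap R A)).under R = p ∧
        p.map (algebraMap R A) ∈ (I.map (algebraMap R A)).minimalPrimes := by
    intro p hp hpq
    haveI : p.IsPrime := hp.1.1
    have hdisj : Disjoint (q.primeCompl : Set R) p :=
      Set.disjoint_left.2 fun x hx hxp => hx (hpq hxp)
    have hunder : (p.map (algebraMap R A)).under R = p :=
      IsLocalization.under_map_of_isPrime_disjoint q.primeCompl A inferInstance hdisj
    refine ⟨IsLocalization.isPrime_of_isPrime_disjoint q.primeCompl A p inferInstance hdisj,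
      hunder, ?_⟩
    rw [hmin, Set.mem_preimage, hunder]
    exact hp
  constructor
  · rintro ⟨p, ⟨hp, hpq⟩, huniq⟩
    obtain ⟨hPprime, hPunder, hPmin⟩ := hext p hp hpq
    -- every minimal prime over `I R_q` is `p R_q`
    have hall : (I.map (algebraMap R A)).minimalPrimes = {p.map (algebraMap R A)} := by
      refine Set.eq_singleton_iff_unique_mem.2 ⟨hPmin, fun P hP => ?_⟩
      haveI : P.IsPrime := hP.1.1
      have hPu : P.under R ∈ I.minimalPrimes := by
        rw [hmin] at hP
        exact hP
      have hPq : P.under R ≤ q := under_le_of_isPrime_of_isLocalization_atPrime q P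
      have hEq : P.under R = p := huniq _ ⟨hPu, hPq⟩
      rw [← IsLocalization.map_under q.primeCompl A P]
      exact congrArg _ hEq
    rw [← Ideal.sInf_minimalPrimes, hall, sInf_singleton]
    exact hPprime
  · intro hrad
    have hall : (I.map (algebraMap R A)).minimalPrimes = {(I.map (algebraMap R A)).radical} := by
      rw [← Ideal.radical_minimalPrimes]
      exact Ideal.minimalPrimes_eq_subsingleton_self
    haveI := hrad
    set P := (I.map (algebraMap R A)).radical with hPdef
    have hPmin : P ∈ (I.map (algebraMap R A)).minimalPrimes := by
      rw [hall]; exact Set.mem_singleton _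
    have hPu : P.under R ∈ I.minimalPrimes := by
      rw [hmin] at hPmin
      exact hPmin
    refine ⟨P.under R, ⟨hPu, under_le_of_isPrime_of_isLocalization_atPrime q P⟩, ?_⟩
    rintro p ⟨hp, hpq⟩
    obtain ⟨-, hpunder, hpmin⟩ := hext p hp hpq
    rw [hall, Set.mem_singleton_iff] at hpmin
    rw [← hpunder, hpmin]

/-- If `V(I)` is irreducible (the radical of `I` is prime), then every prime `q ⊇ I` contains
exactly one minimal prime over `I`, namely `√I`. [cite: AtiyahMacdonald1969, Prop. 1.14] -/
theorem existsUnique_minimalPrimes_le_of_isPrime_radical {I q : Ideal R} [q.IsPrime]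
    (hI : I.radical.IsPrime) (hle : I ≤ q) : ∃! p, p ∈ I.minimalPrimes ∧ p ≤ q := by
  have hall : I.minimalPrimes = {I.radical} := by
    rw [← Ideal.radical_minimalPrimes]
    exact Ideal.minimalPrimes_eq_subsingleton_self
  refine ⟨I.radical, ⟨by rw [hall]; exact Set.mem_singleton _,
    (Ideal.IsPrime.radical_le_iff inferInstance).2 hle⟩, ?_⟩
  rintro p ⟨hp, -⟩
  rw [hall, Set.mem_singleton_iff] at hp
  exact hp

/-- If `R_q ⧸ I R_q` is a domain (e.g. a regular local ring — the case of a smooth point of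
`V(I)`), then exactly one minimal prime over `I` lies inside `q`.
[cite: AtiyahMacdonald1969, Cor. 3.13] -/
theorem existsUnique_minimalPrimes_le_of_isDomain_quotient_map (q : Ideal R) [q.IsPrime]
    [IsLocalization.AtPrime A q] (I : Ideal R)
    (hdom : IsDomain (A ⧸ I.map (algebraMap R A))) : ∃! p, p ∈ I.minimalPrimes ∧ p ≤ q := by
  rw [existsUnique_minimalPrimes_le_iff_isPrime_radical_map (A := A) q I]
  haveI : (I.map (algebraMap R A)).IsPrime := (Ideal.Quotient.isDomain_iff_prime _).1 hdom
  rw [Ideal.IsPrime.radical inferInstance]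
  infer_instance

end AtPrime

end Literature.RingTheory.Localization
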